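import Summits.BirchSwinnertonDyer.BirchSwinnertonDyer.Theorems.SignedLowerHalvesKobayashiLowerHalfSemistableScopeS
import Summits.BirchSwinnertonDyer.Rank1Residual.Partition.MainConjecturesSignedRankOne
import HarnessLib

/-!
# Row C3's supersingular sub-case (register row D2 = `JSW-ss`) and X6 ∧ {r_an = 1} at `p = 3`, RE-ROUTED to the
# cell-refereed S-scoped tiers of Burungale–Skinner–Tian–Wan Thm. 1.3 (cell `bsd-litref`, paper sub-dir `bstw24`,
# seat `bsd-litref-bstw24-pv` = the T2b prover: «re-route consumers to the refereed statement»)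

HONEST FRAMING (programme BSD-LIT2PART v1 §HONESTY; cell README): nothing here proves BSD for any curve; an ANNOUNCED
preprint (BSTW, arXiv:2409.01350v2) enters ONLY as the two explicitly labelled OPEN tier binders
`BurungaleSkinnerTianWan2024_thm13_scopedS_OPEN` (`p ≥ 5`) / `…_scopedAtThreeS_OPEN` (`p = 3`) of
`Supersingular/KobayashiMainConjectureX6BSTWScopeS.lean` (p441607) — the regime of the line-by-line in-cell
verification of record (bsd-ssimc REPORT-bstw-6 / -9 PASS at `p ≥ 5`, G-ledger EMPTY; at `p = 3` the same chain plus the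
located residual (3-ii)♭ = Ohta's Λ-adic Eichler–Shimura at 3 ⇐ [SV-S-Ohta] PRE) —, NEVER the printed binder and
NEVER a theorem; published results are consumed BY NAME. PARTITION (D-0054): register row D2 (`JSW-ss`; 1 849 (class, p)
rows N < 5·10⁵: 880 @ 3, 969 @ p ≥ 5 — `pub/bsd-ssimc/audit1/D2_jswss_classes.tsv`) + X6 r1 @ 3 — types-the-object-of
(consumer re-route); closes none; 0 classes move by this file (referee C2 → A price the tier word after the bstw24
sheets); `--supports stmt-BirchSwinnertonDyer-19000 --as helper`, riding with the crux-2 ScopeS family exactly as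
p441716's r1 consumer does.

## Why this file

The tree's row-C3 consumer at main-conjecture level, `RowC3.bsdp_rankOne_ss_of_BSTW13_OPEN_of_corA5`
(`Partition/MainConjecturesSignedRankOne.lean:126`: «the kernel referees BSTW Thm. 1.3 ⇒ the supersingular case of
JSW Thm. 1.2.1»), and the X6 r1 consumer `X6.bsdp_of_BSTW13_OPEN_of_corA5_of_analyticRank_eq_one`
(`Supersingular/SignedRankOneCorA5.lean:205`) bind the PRINTED binder `BurungaleSkinnerTianWan2024_thm13_OPEN`. The
statement the cell actually verified is the pair of S-scoped tiers; Theorems-side twins exist for X6 r0 (both tiers)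
and X6 r1 at `p ≥ 5` (`SignedLowerHalvesKobayashiLowerHalfSemistableScopeS.lean` :171 / :191 / :211), but NOT for
X6 r1 at `p = 3` and NOT for row C3 at either tier. This file supplies exactly those, witness-free and class-wide
(the scope hypothesis `BSTWScope.HasAuxWitness` is a theorem for every semistable `W` at every odd good supersingular
`p`: `BSTWScope_hasAuxWitness_of_goodSS`, modularity + Diamond 1995 / Ribet 1990 by name), so that the D2 rows and the
X6 r1 pairs read, in the kernel, modulo ONE named PRE tier binder per prime regime + PUBLISHED named facts
(Burungale–Kobayashi–Ota 2024 App. A Cor. A.5 ∘ Kobayashi 2003 Thm. 7.4 `hA5` — its referee flags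
`BKO24-CorA5-IMC-unpinned` / `BKO24-CorA5-proof-by-reference-Kob14` ride with it —, modularity `hmod'`/`hmod`,
Gross–Zagier–Kolyvagin `hGZK`, Diamond/Ribet `hLL`). Cor. A.5 is stated for every odd good `p` with `a_p = 0`
(`corA5_pPart_of_signedCharIdeal_eq`), so the `p = 3` tier composes with it verbatim.

## Contents (theorems only; no `def`, no new binder)

* `X6_bsdp_of_thm13_scopedAtThreeS_OPEN_of_corA5_of_analyticRank_eq_one` — X6 ∧ {r_an = 1} at `p = 3`.
* `X6_bsdp_of_tiersS_S3_of_corA5_of_analyticRank_eq_one` — X6 ∧ {r_an = 1} at every odd `p` (dispatcher).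
* `RowC3_bsdp_rankOne_ss_of_thm13_scopedS_OPEN_of_corA5` — row C3 ∩ {`p ∣ a_p`} at `p ≥ 5`.
* `RowC3_bsdp_rankOne_ss_of_thm13_scopedAtThreeS_OPEN_of_corA5` — row C3 ∩ {`3 ∣ a_3`} at `p = 3`.
* `RowC3_bsdp_rankOne_ss_of_tiersS_S3_of_corA5` — row C3 ∩ {`p ∣ a_p`} at every prime of the row.
* `RowC3_bsdp_rankOne_ss_of_thm13_OPEN_via_tiersS_S3` — sanity: the re-routed road is never stronger than the printed
  binder (composition with `thm13_scopedS_OPEN_of_thm13_OPEN` / `thm13_scopedAtThreeS_OPEN_of_thm13_OPEN`).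

What this file is NOT: not a verification of BSTW (that is bsd-ssimc's MEMO/REPORT series and the bsd-litref-bstw24-r1, -r2
D-audit sheets); not a booking; not a claim that row D2 moves (referee A's word on the tier of the S-scoped binders and
on Cor. A.5's flags decides that); not a typing of (3-ii)♭.

References: [BurungaleSkinnerTianWan2024] Thm. 1.3 / 1.5 (PRE); [JetchevSkinnerWan2017] Thm. 1.2.1; [BurungaleKobayashiOta2023]
App. A Cor. A.5; [Kobayashi2003] Thm. 7.4, Conjecture p. 2; [Ribet1990] Thm. 1.1; [Diamond1995RefinedSerre] Thm. 1.1;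
[Miller2011LMS] Def. 1.1; cell records pub/bsd-litref/bstw24/staging/bsd-litref-bstw24-pv/CONSUMERS.md §2 rows 2–3,
pub/bsd-ssimc REPORT-bstw-6, -7, -9, TARGET §1.1 (D2 rider).
-/

set_option autoImplicit false
set_option linter.dupNamespace false

noncomputable section

open scoped Classical MatrixGroups ModularForm

open CongruenceSubgroup WeierstrassCurve NumberField Literature.NumberTheory.EllipticCurves
  Literature.NumberTheory.EllipticCurves.ModularForms
  Literature.NumberTheory.EllipticCurves.Rank1Residual
  Literature.NumberTheory.EllipticCurves.Rank1Residual.Typed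
  Literature.NumberTheory.EllipticCurves.BurungaleKobayashiOta2024
  Summit.BirchSwinnertonDyer.Rank1Residual
  Summit.BirchSwinnertonDyer.Rank1Residual.Supersingular

namespace Summit.BirchSwinnertonDyer.BirchSwinnertonDyer.Theorems

/-! ### X6 ∧ {r_an = 1} at `p = 3` and at every odd `p` -/

/-- **X6 ∧ {r_an = 1} at `p = 3`: `BSD(E,3)` CLASS-WIDE, MODULO the ONE `p = 3` S-scoped PRE tier binder** (which rests,
beyond the `p ≥ 5` chain, on the located residual (3-ii)♭ = Ohta's Λ-adic Eichler–Shimura at 3, PRE), via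
Burungale–Kobayashi–Ota 2024 Cor. A.5 ∘ Kobayashi Thm. 7.4 (`hA5`, PUB, stated for every odd good `p` with `a_p = 0`; its
two referee flags ride with it), modularity (`hmod'`, `hmod`), GZK (`hGZK`) and Diamond/Ribet (`hLL`, which make the scope
witness free) — the `p = 3` twin of `X6_bsdp_of_thm13_scopedS_OPEN_of_corA5_of_analyticRank_eq_one`. PRE-tier;
CONDITIONAL; closes nothing; nothing booked. [claim: BurungaleSkinnerTianWan2024, status: under-review]
[cite: BurungaleKobayashiOta2023, App. A Cor. A.5] [cite: Kobayashi2003, Thm. 7.4 (p. 13)] [cite: Miller2011LMS, §1 and Def. 1.1] -/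
theorem X6_bsdp_of_thm13_scopedAtThreeS_OPEN_of_corA5_of_analyticRank_eq_one
    (h : BurungaleSkinnerTianWan2024_thm13_scopedAtThreeS_OPEN)
    (hA5 : corA5_pPart_of_signedCharIdeal_eq) (hmod' : hasEntireLFunction_rat)
    (hGZK : rank_eq_analyticRank_of_analyticRank_le_one)
    (hmod : exists_isNewformOf) (hLL : Literature.NumberTheory.Automorphic.diamond1995_refinedSerre)
    (W : WeierstrassCurve ℚ) [W.IsElliptic] [W.IsGloballyMinimal] (p : ℕ) [Fact p.Prime]
    (h3 : p = 3) (hX : ClassX6 W p) (h1 : W.analyticRank = 1) : BSDp W p :=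
  X6.bsdp_of_kobayashiMainConjecture_of_corA5_of_analyticRank_eq_one W p hA5 hmod' hGZK (by omega) hX h1 1
    (X6_kobayashiMainConjecture_of_thm13_scopedAtThreeS_OPEN h hmod hLL W p h3 hX 1)

/-- **X6 ∧ {r_an = 1} at EVERY odd prime: `BSD(E,p)` CLASS-WIDE, MODULO the two S-scoped PRE tier binders** (`p ≥ 5` via
`X6_bsdp_of_thm13_scopedS_OPEN_of_corA5_of_analyticRank_eq_one`, `p = 3` via the theorem above; an odd prime is `≥ 5` or
`= 3`). PRE-tier; CONDITIONAL; closes nothing. [claim: BurungaleSkinnerTianWan2024, status: under-review]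
[cite: BurungaleKobayashiOta2023, App. A Cor. A.5] [cite: Miller2011LMS, §1 and Def. 1.1] -/
theorem X6_bsdp_of_tiersS_S3_of_corA5_of_analyticRank_eq_one
    (h5t : BurungaleSkinnerTianWan2024_thm13_scopedS_OPEN)
    (h3t : BurungaleSkinnerTianWan2024_thm13_scopedAtThreeS_OPEN)
    (hA5 : corA5_pPart_of_signedCharIdeal_eq) (hmod' : hasEntireLFunction_rat)
    (hGZK : rank_eq_analyticRank_of_analyticRank_le_one)
    (hmod : exists_isNewformOf) (hLL : Literature.NumberTheory.Automorphic.diamond1995_refinedSerre)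
    (W : WeierstrassCurve ℚ) [W.IsElliptic] [W.IsGloballyMinimal] (p : ℕ) [Fact p.Prime]
    (hp : p ≠ 2) (hX : ClassX6 W p) (h1 : W.analyticRank = 1) : BSDp W p := by
  by_cases hp5 : 5 ≤ p
  · exact X6_bsdp_of_thm13_scopedS_OPEN_of_corA5_of_analyticRank_eq_one h5t hA5 hmod' hGZK hmod hLL W p hp5 hX h1
  · have hpP : p.Prime := Fact.out
    have hp3 : p = 3 := by
      have h2 := hpP.two_le
      interval_cases p
      · exact absurd rfl hp
      · rfl
      · exact absurd hpP (by decide)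
    exact X6_bsdp_of_thm13_scopedAtThreeS_OPEN_of_corA5_of_analyticRank_eq_one h3t hA5 hmod' hGZK hmod hLL W p
      hp3 hX h1

/-! ### Row C3 ∩ {`p ∣ a_p`} = register row D2 (`JSW-ss`), re-routed to the S-scoped tiers -/

/-- **Row C3 ∩ {`p ∣ a_p`} at `p ≥ 5` (register row D2 = `JSW-ss`, 969 (class, p) rows @ p ≥ 5): `BSD(E,p)` CLASS-WIDE,
MODULO the ONE `p ≥ 5` S-scoped PRE tier binder** — the cell-verified regime of BSTW Thm. 1.3 (bsd-ssimc REPORT-bstw-6, -9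
PASS, G-ledger EMPTY) — + the PUBLISHED rank-one link Burungale–Kobayashi–Ota Cor. A.5 ∘ Kobayashi Thm. 7.4 (`hA5`),
modularity, GZK, Diamond/Ribet; a row-C3 pair with `p ∣ a_p` is an X6 pair (`RowC3.classX6_of_dvd`). The tree's
`RowC3.bsdp_rankOne_ss_of_BSTW13_OPEN_of_corA5` re-routed from the printed binder to the refereed statement.
PRE-tier; CONDITIONAL; closes nothing; nothing booked. [claim: BurungaleSkinnerTianWan2024, status: under-review]
[cite: JetchevSkinnerWan2017, Thm. 1.2.1 (§1.2)] [cite: BurungaleKobayashiOta2023, App. A Cor. A.5]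
[cite: Kobayashi2003, Thm. 7.4 (p. 13)] [cite: Miller2011LMS, §1 and Def. 1.1] -/
theorem RowC3_bsdp_rankOne_ss_of_thm13_scopedS_OPEN_of_corA5
    (h : BurungaleSkinnerTianWan2024_thm13_scopedS_OPEN)
    (hA5 : corA5_pPart_of_signedCharIdeal_eq) (hmod' : hasEntireLFunction_rat)
    (hGZK : rank_eq_analyticRank_of_analyticRank_le_one)
    (hmod : exists_isNewformOf) (hLL : Literature.NumberTheory.Automorphic.diamond1995_refinedSerre)
    (W : WeierstrassCurve ℚ) [W.IsElliptic] [W.IsGloballyMinimal] (p : ℕ) [Fact p.Prime]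
    (h5 : 5 ≤ p) (hC3 : RowC3 W p) (hss : (p : ℤ) ∣ W.frobeniusTrace p) : BSDp W p :=
  X6_bsdp_of_thm13_scopedS_OPEN_of_corA5_of_analyticRank_eq_one h hA5 hmod' hGZK hmod hLL W p h5
    (RowC3.classX6_of_dvd hC3 hss) hC3.1

/-- **Row C3 ∩ {`3 ∣ a_3`} at `p = 3` (register row D2 @ 3: 880 classes, 757 flag-only): `BSD(E,3)` CLASS-WIDE, MODULO
the ONE `p = 3` S-scoped PRE tier binder** (+ (3-ii)♭ behind it) + Cor. A.5 ∘ Kobayashi Thm. 7.4, modularity, GZK,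
Diamond/Ribet; the row's clause at 3 («ordinary or `a_3 = 0`») with `3 ∣ a_3` forces `a_3 = 0` (`RowC3.classX6_of_dvd`).
PRE-tier; CONDITIONAL; closes nothing; nothing booked. [claim: BurungaleSkinnerTianWan2024, status: under-review]
[cite: JetchevSkinnerWan2017, Thm. 1.2.1 (§1.2)] [cite: BurungaleKobayashiOta2023, App. A Cor. A.5]
[cite: Kobayashi2003, Thm. 7.4 (p. 13)] [cite: Miller2011LMS, §1 and Def. 1.1] -/
theorem RowC3_bsdp_rankOne_ss_of_thm13_scopedAtThreeS_OPEN_of_corA5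
    (h : BurungaleSkinnerTianWan2024_thm13_scopedAtThreeS_OPEN)
    (hA5 : corA5_pPart_of_signedCharIdeal_eq) (hmod' : hasEntireLFunction_rat)
    (hGZK : rank_eq_analyticRank_of_analyticRank_le_one)
    (hmod : exists_isNewformOf) (hLL : Literature.NumberTheory.Automorphic.diamond1995_refinedSerre)
    (W : WeierstrassCurve ℚ) [W.IsElliptic] [W.IsGloballyMinimal] (p : ℕ) [Fact p.Prime]
    (h3 : p = 3) (hC3 : RowC3 W p) (hss : (p : ℤ) ∣ W.frobeniusTrace p) : BSDp W p :=
  X6_bsdp_of_thm13_scopedAtThreeS_OPEN_of_corA5_of_analyticRank_eq_one h hA5 hmod' hGZK hmod hLL W p h3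
    (RowC3.classX6_of_dvd hC3 hss) hC3.1

/-- **Row C3 ∩ {`p ∣ a_p`} at EVERY prime of the row (`p ≥ 5`, or `p = 3` with the row's clause): `BSD(E,p)`
CLASS-WIDE, MODULO the two S-scoped PRE tier binders** + Cor. A.5, modularity, GZK, Diamond/Ribet — the whole register
row D2 (`JSW-ss`) re-routed to the cell-refereed statement of BSTW Thm. 1.3, one tier per prime regime. PRE-tier;
CONDITIONAL; closes nothing; nothing booked. [claim: BurungaleSkinnerTianWan2024, status: under-review]
[cite: JetchevSkinnerWan2017, Thm. 1.2.1 (§1.2)] [cite: BurungaleKobayashiOta2023, App. A Cor. A.5]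
[cite: Miller2011LMS, §1 and Def. 1.1] -/
theorem RowC3_bsdp_rankOne_ss_of_tiersS_S3_of_corA5
    (h5t : BurungaleSkinnerTianWan2024_thm13_scopedS_OPEN)
    (h3t : BurungaleSkinnerTianWan2024_thm13_scopedAtThreeS_OPEN)
    (hA5 : corA5_pPart_of_signedCharIdeal_eq) (hmod' : hasEntireLFunction_rat)
    (hGZK : rank_eq_analyticRank_of_analyticRank_le_one)
    (hmod : exists_isNewformOf) (hLL : Literature.NumberTheory.Automorphic.diamond1995_refinedSerre)
    (W : WeierstrassCurve ℚ) [W.IsElliptic] [W.IsGloballyMinimal] (p : ℕ) [Fact p.Prime]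
    (hC3 : RowC3 W p) (hss : (p : ℤ) ∣ W.frobeniusTrace p) : BSDp W p :=
  X6_bsdp_of_tiersS_S3_of_corA5_of_analyticRank_eq_one h5t h3t hA5 hmod' hGZK hmod hLL W p (RowC3.ne_two hC3)
    (RowC3.classX6_of_dvd hC3 hss) hC3.1

/-- **Sanity: the re-routed road is never stronger than the printed binder.** Both S-scoped tiers are implied by
`BurungaleSkinnerTianWan2024_thm13_OPEN` (`thm13_scopedS_OPEN_of_thm13_OPEN`, `thm13_scopedAtThreeS_OPEN_of_thm13_OPEN`),
so row C3 ∩ {`p ∣ a_p`} ⟸ {printed binder, Cor. A.5, modularity, GZK, Diamond/Ribet} — the content of the tree's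
`RowC3.bsdp_rankOne_ss_of_BSTW13_OPEN_of_corA5`, recovered through the tiers. Composition only; closes nothing.
[claim: BurungaleSkinnerTianWan2024, status: under-review] [cite: JetchevSkinnerWan2017, Thm. 1.2.1 (§1.2)] -/
theorem RowC3_bsdp_rankOne_ss_of_thm13_OPEN_via_tiersS_S3
    (h : BurungaleSkinnerTianWan2024_thm13_OPEN)
    (hA5 : corA5_pPart_of_signedCharIdeal_eq) (hmod' : hasEntireLFunction_rat)
    (hGZK : rank_eq_analyticRank_of_analyticRank_le_one)
    (hmod : exists_isNewformOf) (hLL : Literature.NumberTheory.Automorphic.diamond1995_refinedSerre)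
    (W : WeierstrassCurve ℚ) [W.IsElliptic] [W.IsGloballyMinimal] (p : ℕ) [Fact p.Prime]
    (hC3 : RowC3 W p) (hss : (p : ℤ) ∣ W.frobeniusTrace p) : BSDp W p :=
  RowC3_bsdp_rankOne_ss_of_tiersS_S3_of_corA5 (thm13_scopedS_OPEN_of_thm13_OPEN h)
    (thm13_scopedAtThreeS_OPEN_of_thm13_OPEN h) hA5 hmod' hGZK hmod hLL W p hC3 hss


/-! ### APPEND (same seat, same session): the capstones' ONE typed input `hKMC`, DISCHARGED from the two S-scoped tiers -/

/-- **Kobayashi's main conjecture on X6 at EVERY odd prime, every sign, witness-free, MODULO the two S-scoped PRE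
tier binders** (`p ≥ 5` via `X6_kobayashiMainConjecture_of_thm13_scopedS_OPEN`, `p = 3` via
`X6_kobayashiMainConjecture_of_thm13_scopedAtThreeS_OPEN`; an odd prime is `≥ 5` or `= 3`) + modularity and
Diamond/Ribet by name. The witness-free form of `X6.kobayashiMainConjecture_of_thm13_scopedS_OPEN_of_scopedAtThreeS_OPEN_of_hasAuxWitness`.
PRE-tier; CONDITIONAL; closes nothing. [claim: BurungaleSkinnerTianWan2024, status: under-review]
[cite: Kobayashi2003, Conjecture (Main Conjecture) (p. 2)] -/
theorem X6_kobayashiMainConjecture_of_tiersS_S3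
    (h5t : BurungaleSkinnerTianWan2024_thm13_scopedS_OPEN)
    (h3t : BurungaleSkinnerTianWan2024_thm13_scopedAtThreeS_OPEN)
    (hmod : exists_isNewformOf) (hLL : Literature.NumberTheory.Automorphic.diamond1995_refinedSerre)
    (W : WeierstrassCurve ℚ) [W.IsElliptic] [W.IsGloballyMinimal] (p : ℕ) [Fact p.Prime]
    (hp : p ≠ 2) (hX : ClassX6 W p) (ε : ℤˣ) : KobayashiMainConjecture W p ε := by
  by_cases hp5 : 5 ≤ p
  · exact X6_kobayashiMainConjecture_of_thm13_scopedS_OPEN h5t hmod hLL W p hp5 hX ε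
  · have hpP : p.Prime := Fact.out
    have hp3 : p = 3 := by
      have h2 := hpP.two_le
      interval_cases p
      · exact absurd rfl hp
      · rfl
      · exact absurd hpP (by decide)
    exact X6_kobayashiMainConjecture_of_thm13_scopedAtThreeS_OPEN h3t hmod hLL W p hp3 hX ε

/-- **The Partition capstones' ONE typed input `hKMC` — «Kobayashi's signed main conjecture on row C3 ∩ {p ∣ a_p}» —
in its EXACT binder shape `RowC3 W p → (p : ℤ) ∣ a_p(W) → KobayashiMainConjecture W p ε`, DISCHARGED from the two
S-scoped PRE tier binders** (+ modularity `hmod`, Diamond/Ribet `hLL`): feed this term as `hKMC` to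
`Rank1Residual.bsdp_of_covered_of_mainConjectures_allPrimes_published` (`Partition/MainConjecturesCoveredAllPrimesPublished.lean`),
`RowC3.bsdp_of_publishedFacts_of_kobayashiMainConjecture`, `…ControlJSWClass` / `…ControlPublishedClass` /
`CornersMainConjectures{,Cor54}` — every one of them then reads «Covered ⟹ BSD_p» modulo PUBLISHED named facts + these
two cell-refereed PRE binders (and their own `htam` / final-statement provisos), with NO typed main-conjecture input
left. A row-C3 pair with `p ∣ a_p` is an X6 pair at an odd prime (`RowC3.classX6_of_dvd`, `RowC3.ne_two`). PRE-tier;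
CONDITIONAL; closes nothing; nothing booked. [claim: BurungaleSkinnerTianWan2024, status: under-review]
[cite: JetchevSkinnerWan2017, Thm. 1.2.1 (§1.2)] [cite: Kobayashi2003, Conjecture (Main Conjecture) (p. 2)] -/
theorem RowC3_kobayashiMainConjecture_ss_of_tiersS_S3
    (h5t : BurungaleSkinnerTianWan2024_thm13_scopedS_OPEN)
    (h3t : BurungaleSkinnerTianWan2024_thm13_scopedAtThreeS_OPEN)
    (hmod : exists_isNewformOf) (hLL : Literature.NumberTheory.Automorphic.diamond1995_refinedSerre)
    (W : WeierstrassCurve ℚ) [W.IsElliptic] [W.IsGloballyMinimal] (p : ℕ) [Fact p.Prime] (ε : ℤˣ) :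
    RowC3 W p → (p : ℤ) ∣ W.frobeniusTrace p → KobayashiMainConjecture W p ε :=
  fun hC3 hss ↦ X6_kobayashiMainConjecture_of_tiersS_S3 h5t h3t hmod hLL W p (RowC3.ne_two hC3)
    (RowC3.classX6_of_dvd hC3 hss) ε

/-! ### APPEND (seat `bsd-litref-bstw24-pv` gen 5, 2026-08-27; HUMAN RULING D-0120, rung W-ALL): the corner
«X6 ∧ r_an = 0» of `Rank1Residual.bsdp_allCurves_of_not_corner_of_not_cornerF` at EVERY odd prime under ONE name, and
class X6 in analytic rank `≤ 1` at every odd prime — MODULO the two S-scoped PRE tier binders + PUBLISHED named facts;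
Pollack's ± `p`-adic `L`-function input is NOT a hypothesis: it is the tree THEOREM
`pollack_exists_plusMinusPAdicLFunction_holds` (Pollack 2003 Thm. 5.6 / Cor. 5.11 / Prop. 6.18, PROVED in
`PlusMinusPAdicLFunctionProofs.lean`) -/

/-- **Corner X6 ∧ {r_an = 0} at EVERY odd prime (rung W-ALL, D-0120; the fourth non-CM corner of
`Partition/CornersAll.lean`): `BSD(E,p)` CLASS-WIDE for every semistable `W/ℚ` with good supersingular reduction at an
odd `p` (`a_3 = 0` if `p = 3`) and analytic rank `0`, MODULO the two S-scoped PRE tier binders of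
Burungale–Skinner–Tian–Wan Thm. 1.3** — `p ≥ 5`: `…thm13_scopedS_OPEN`, the cell-refereed regime (bsd-ssimc REPORT-bstw-6 /
-9 PASS; bsd-litref referee C4 round C4-R3 (ζ): O6/O7 at `p ≥ 5` «PASS-in-cell WITH CELL REPAIRS, CONCUR ×2»); `p = 3`:
`…thm13_scopedAtThreeS_OPEN`, the same chain at 3, whose LOCATED `p = 3` inputs of record are kept current in that
binder's docstring and in the why-text of route `SignedLowerHalves` item 2 (not restated here); both tiers PRE —
everything else PUBLISHED and by name: Wuthrich 2014 Prop. 21 (`hW`), Kobayashi 2003 Thm. 1.2 (`h12`), B. D. Kim 2013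
Cor. 3.15 (`hKim`), modularity (`hmodP`, `hmod'`, `hmod`), Gross–Zagier–Kolyvagin (`hGZK`), Diamond 1995 / Ribet 1990
(`hLL`). Pollack 2003 (existence of the ± `p`-adic `L`-functions) is DISCHARGED inside by the tree theorem
`pollack_exists_plusMinusPAdicLFunction_holds` — one hypothesis FEWER than the per-tier twins
`X6_bsdp_of_thm13_scopedS_OPEN_of_analyticRank_eq_zero` / `X6_bsdp_of_thm13_scopedAtThreeS_OPEN_of_analyticRank_eq_zero`
(`SignedLowerHalvesKobayashiLowerHalfSemistableScopeS.lean`) over which this dispatches (an odd prime is `≥ 5` or `= 3`).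
This is the alt-closer BY NAME of W-ALL's exclusion class «X6 ∧ r = 0» (cell `bsd-wall`, lane (2)): the conclusion is
literally `p ≠ 2 → ClassX6 W p → W.analyticRank = 0 → BSDp W p`. PRE-tier; CONDITIONAL; closes nothing; nothing
booked. [claim: BurungaleSkinnerTianWan2024, status: under-review] [cite: Wuthrich2014, Prop. 21 (p. 400)]
[cite: Kobayashi2003, Thm. 1.2] [cite: Pollack2003, Thm. 5.6, Cor. 5.11 and Prop. 6.18] [cite: Miller2011LMS, §1 and Def. 1.1] -/
theorem X6_bsdp_of_tiersS_S3_of_analyticRank_eq_zero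
    (h5t : BurungaleSkinnerTianWan2024_thm13_scopedS_OPEN)
    (h3t : BurungaleSkinnerTianWan2024_thm13_scopedAtThreeS_OPEN)
    (hW : Wuthrich2014.sha_dvd_analyticSha)
    (h12 : Kobayashi2003.thm12_signedSelmerDual_finite_torsion)
    (hKim : BDKim2013.cor315_signedCharValue_rankZero)
    (hmodP : nonempty_modularParametrizationData) (hmod' : hasEntireLFunction_rat)
    (hGZK : rank_eq_analyticRank_of_analyticRank_le_one)
    (hmod : exists_isNewformOf) (hLL : Literature.NumberTheory.Automorphic.diamond1995_refinedSerre)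
    (W : WeierstrassCurve ℚ) [W.IsElliptic] [W.IsGloballyMinimal] (p : ℕ) [Fact p.Prime]
    (hp : p ≠ 2) (hX : ClassX6 W p) (h0 : W.analyticRank = 0) : BSDp W p := by
  have hPollack : ∀ {N : ℕ} [NeZero N] {f : CuspForm (Gamma0 N) 2},
      pollack_exists_plusMinusPAdicLFunction (W := W) (f := f) (p := p) :=
    fun {N} _ {f} ↦ pollack_exists_plusMinusPAdicLFunction_holds
  by_cases hp5 : 5 ≤ p
  · exact X6_bsdp_of_thm13_scopedS_OPEN_of_analyticRank_eq_zero h5t hW h12 hKim W p hPollack hmodP hmod' hGZK hmod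
      hLL hp5 hX h0
  · have hpP : p.Prime := Fact.out
    have hp3 : p = 3 := by
      have h2 := hpP.two_le
      interval_cases p
      · exact absurd rfl hp
      · rfl
      · exact absurd hpP (by decide)
    exact X6_bsdp_of_thm13_scopedAtThreeS_OPEN_of_analyticRank_eq_zero h3t hW h12 hKim W p hPollack hmodP hmod' hGZK
      hmod hLL hp3 hX h0

/-- **Class X6 in analytic rank `≤ 1` at EVERY odd prime: `BSD(E,p)` CLASS-WIDE, MODULO the two S-scoped PRE tier
binders** — rank `0` by `X6_bsdp_of_tiersS_S3_of_analyticRank_eq_zero`, rank `1` by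
`X6_bsdp_of_tiersS_S3_of_corA5_of_analyticRank_eq_one` (+ Burungale–Kobayashi–Ota 2024 App. A Cor. A.5 ∘ Kobayashi
Thm. 7.4 `hA5`, PUB; its two referee flags ride with it). One name for «BSTW Thm. 1.3 ⇒ Thm. 1.5 on class X6, `r ≤ 1`»
in the kernel, the preprint entering ONLY through the two cell-refereed tier binders. (In `CornersAll` the rank-one half
of X6 is NOT a corner — it is covered in print by Jetchev–Skinner–Wan 2017 Thm. 1.2.1, `hJSW`; this is the BSTW-side
second road for it.) PRE-tier; CONDITIONAL; closes nothing; nothing booked.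
[claim: BurungaleSkinnerTianWan2024, status: under-review] [cite: BurungaleKobayashiOta2023, App. A Cor. A.5]
[cite: Wuthrich2014, Prop. 21 (p. 400)] [cite: Miller2011LMS, §1 and Def. 1.1] -/
theorem X6_bsdp_of_tiersS_S3_of_corA5_of_analyticRank_le_one
    (h5t : BurungaleSkinnerTianWan2024_thm13_scopedS_OPEN)
    (h3t : BurungaleSkinnerTianWan2024_thm13_scopedAtThreeS_OPEN)
    (hW : Wuthrich2014.sha_dvd_analyticSha)
    (h12 : Kobayashi2003.thm12_signedSelmerDual_finite_torsion)
    (hKim : BDKim2013.cor315_signedCharValue_rankZero)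
    (hA5 : corA5_pPart_of_signedCharIdeal_eq)
    (hmodP : nonempty_modularParametrizationData) (hmod' : hasEntireLFunction_rat)
    (hGZK : rank_eq_analyticRank_of_analyticRank_le_one)
    (hmod : exists_isNewformOf) (hLL : Literature.NumberTheory.Automorphic.diamond1995_refinedSerre)
    (W : WeierstrassCurve ℚ) [W.IsElliptic] [W.IsGloballyMinimal] (p : ℕ) [Fact p.Prime]
    (hp : p ≠ 2) (hX : ClassX6 W p) (hr : W.analyticRank ≤ 1) : BSDp W p := by
  obtain h0 | h1 : W.analyticRank = 0 ∨ W.analyticRank = 1 := by omega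
  · exact X6_bsdp_of_tiersS_S3_of_analyticRank_eq_zero h5t h3t hW h12 hKim hmodP hmod' hGZK hmod hLL W p hp hX h0
  · exact X6_bsdp_of_tiersS_S3_of_corA5_of_analyticRank_eq_one h5t h3t hA5 hmod' hGZK hmod hLL W p hp hX h1

end Summit.BirchSwinnertonDyer.BirchSwinnertonDyer.Theorems

end
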